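import Summits.BirchSwinnertonDyer.BirchSwinnertonDyer.Theorems.SignedLowerHalvesBDKimSignedCharValueRankZeroOfPoitouTate
import Summits.BirchSwinnertonDyer.BirchSwinnertonDyer.Theorems.ThetaPartnerAtTwoSignedControlAtTwoShaTwoPrimaryVanishingOdd
import HarnessLib

/-!
# B. D. Kim 2013 Cor. 3.15 (item stmt-BirchSwinnertonDyer-19288 BY NAME, input F10 of rows 6–8) from the TWO generic Poitou–Tate
# rows {PT-Sel, PT-Ш} over `ℚ` — the archimedean rows PT3ℝ / PT2ℝ DROPPED (odd `p`)

LADDER-BSD D-0154 (2) INPUTS→UNCONDITIONAL, INPUTS-LIST-2 row F10, ADDENDUM-6 and -7, tranche **T9** (desk bsd-inputs-plan-2; turnkey sketch),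
`--supports stmt-BirchSwinnertonDyer-19288`. Sequel of seat kim315-p1's `…BDKimSignedCharValueRankZeroOfChromatic.lean` (p618998: the kernel
`cor315_body_of_cassels_of_shaTwo_of_honda_of_eq` and F10 ⟸ {PT-Sel, PT-Ш, PT3ℝ, PT2ℝ} + TRANSPORT) and `…OfPoitouTate.lean` (p621647:
TRANSPORT proved for both signs, `exists_isHondaSystem_signedSelmerInfty_eq_chromatic`; `cor315_of_poitouTate_rows : PT-Sel → PT-Ш → PT3ℝ → PT2ℝ →
BDKim2013.cor315_signedCharValue_rankZero`). The only use of PT3ℝ (`poitouTate_three_realPlaces_injective ℚ`) and PT2ℝ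
(`poitouTate_two_realPlaces_surjective ℚ`) in that chain is the step `Ш²(ℚ, E[p^∞]) = 0` via `SignedEC.PrimaryTorsionH2.shaTwo_primary_eq_bot_of_poitouTate`
(p618998 l. 276–278); at an ODD prime the pt-p2 seat's `SignedEC.PrimaryTorsionH2.shaTwo_primary_eq_bot_of_ne_two` (p615677 / p617570: `H²(K_w, E[p]) = 0` at
real `w` for `p` odd, `cd_p(Γ_K) ≤ 2`) gives the same vanishing from PT-Ш (`poitouTate_sha_tateDual ℚ`, Milne ADT I Thm. 4.10 (a)) ALONE — exactly
as seat pt-p2 did for F15 (p619288 `sharpFlatCharValue_rankZero_allN_of_poitouTate_of_cyclotomicControl`). §1 re-keys the p618998 kernel, §2 the by-name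
fact under a displayed TRANSPORT, §3 the by-name fact and the three route doors from {PT-Sel, PT-Ш} and NOTHING ELSE: the displayed base of F10 becomes
items 20461 / 20462 of rows 1/7/8 (two XL cites, Milne ADT I 4.10 for Selmer structures and 4.10 (a)).

HONEST FRAMING: THEOREMS ONLY (no definition, no named fact, no instance, no `sorry`); every result is CONDITIONAL on the Poitou–Tate rows
displayed as hypotheses; item 19288 is NOT closed; no summit statement is proved; BSD is not proved by any of this.

References: [BDKim2013] B. D. Kim, Compos. Math. 149 (2013), Cor. 3.15 (p. 199); [MilneADT2006] J. S. Milne, Arithmetic Duality Theorems,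
2nd ed., Ch. I Thm. 4.10 (p. 57), Cor. 4.16; [GreenbergLNM1716] R. Greenberg, LNM 1716 (1999), §4 Prop. 4.13 (p. 122); [SerreGC] J.-P. Serre,
Galois Cohomology, II §4.4 Prop. 13; [Sprung2012] F. Sprung, J. Number Theory 132 (2012), §1 p. 1486, Thm. 2.2; [Cassels1964ArithmeticVII].
-/

set_option autoImplicit false
-- the Theorems namespace of this sub repeats the summit name by design (D-0017 nested layout)
set_option linter.dupNamespace false

noncomputable section

open scoped Classical NumberField

open NumberField IsDedekindDomain

universe u

/-! ## §1 The p618998 kernel with `Ш² = 0` discharged to PT-Ш alone (odd `p`) -/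

namespace Summit.BirchSwinnertonDyer.BirchSwinnertonDyer.Theorems.KimCor315

open Literature.NumberTheory.EllipticCurves Literature.NumberTheory.GaloisRepresentations
  WeierstrassCurve ZpExtension Literature.NumberTheory.EllipticCurves.Kobayashi2003
  Literature.NumberTheory.EllipticCurves.Sprung2017 Literature.NumberTheory.EllipticCurves.Sprung2012
  Literature.NumberTheory.EllipticCurves.Sprung2024 Literature.NumberTheory.EllipticCurves.IwasawaDual
  Literature.NumberTheory.EllipticCurves.IwasawaAlgebra Literature.NumberTheory.GaloisCohomology
  Summit.BirchSwinnertonDyer.BirchSwinnertonDyer.Theorems.SignedEC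
  Summit.BirchSwinnertonDyer.BirchSwinnertonDyer.Theorems.SSFlatEC
  Summit.BirchSwinnertonDyer.BirchSwinnertonDyer.Theorems.SharpFlatCount
open Summit.BirchSwinnertonDyer.Rank1Residual.X11b (LocBridge.primaryGaloisModule)
open Literature.NumberTheory.GaloisRepresentations.DiscreteGaloisModule (shaTwo)

variable {W : WeierstrassCurve ℚ} [W.IsElliptic] {p : ℕ} [Fact p.Prime] {κ : ZpExtension ℚ p} {ε : ℤˣ}
  {v : HeightOneSpectrum (𝓞 ℚ)} {g : Field.absoluteGaloisGroup (v.adicCompletion ℚ)}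
  {c : ℕ → localPoints W (v.adicCompletion ℚ)} {col : Chroma}

/-- **Kim 2013 Cor. 3.15 for ONE datum under the identity `Sel^ε_∞ = Sel^col_∞`, from CASSELS by name and PT-Ш ALONE (odd `p`)**:
as `cor315_body_of_cassels_of_poitouTate_of_honda_of_eq` (p618998) but with `Ш²(ℚ, E[p^∞]) = ⊥` taken from
`SignedEC.PrimaryTorsionH2.shaTwo_primary_eq_bot_of_ne_two` (`p ≠ 2`, `E(ℚ)[p] = 0` at a good supersingular `p ≥ 3`) — the archimedean
rows PT3ℝ / PT2ℝ are NOT hypotheses. [cite: BDKim2013, Cor. 3.15 (pp. 199–200)] [cite: MilneADT2006, Ch. I, Thm. 4.10 (a), Cor. 4.16]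
[cite: GreenbergLNM1716, §4 Prop. 4.13 (p. 122)] -/
theorem cor315_body_of_cassels_of_poitouTateSha_of_honda_of_eq_odd [W.IsGloballyMinimal]
    (hC : Greenberg1999.casselsSurjectivity_H1Sigma ℚ) (hPT : poitouTate_sha_tateDual ℚ)
    (hp2 : p ≠ 2) (hgood : W.HasGoodReductionAtPrime p) (hap : W.frobeniusTrace p = 0) (hκ : κ.IsCyclotomic)
    {γ : Field.absoluteGaloisGroup ℚ} (hγ : κ.IsTopGenerator γ) (D : SignedSelmerDualData W κ γ ε)
    (hv : (p : 𝓞 ℚ) ∈ v.asIdeal) (hg : κ.IsTopGenerator (resGalOfEmb (closureEmb (K := ℚ) (v.adicCompletion ℚ)) g))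
    {cneg : localPoints W (v.adicCompletion ℚ)}
    (hH : IsHondaSystem κ (closureEmb (K := ℚ) (v.adicCompletion ℚ)) W (W.frobeniusTrace p) g cneg c)
    (heq : signedSelmerInfty W κ ε =
      sharpFlatSelmerInfty W κ (closureEmb (K := ℚ) (v.adicCompletion ℚ)) (W.frobeniusTrace p) g c col)
    (hSel : Finite (W.selmerGroupPInfty p)) (f : IwasawaAlgebra p) (hf : D.charIdeal = Ideal.span {f}) :
    Module.IsTorsion (IwasawaAlgebra p) D.X ∧
      ∃ u : ℤ_[p]ˣ,
        ((PowerSeries.constantCoeff f : ℤ_[p]) : ℚ_[p]) =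
          ((u : ℤ_[p]) : ℚ_[p]) * (p : ℚ_[p]) ^ (padicValNat p W.tamagawaProduct) *
            (Nat.card (W.selmerGroupPInfty p) : ℚ_[p]) := by
  have hap' : (p : ℤ) ∣ W.frobeniusTrace p := by rw [hap]; exact dvd_zero _
  refine cor315_body_of_cassels_of_shaTwo_of_honda_of_eq hC hp2 hgood hap hκ hγ D hv hg hH heq (fun hfin ↦ ?_) hSel f hf
  haveI := hfin
  -- `E(ℚ)[p] = 0` (the `DecidableEq ℚ` instance of the group law is bridged by `convert`)
  exact PrimaryTorsionH2.shaTwo_primary_eq_bot_of_ne_two W p hp2 hPT fun P hP ↦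
    no_pTorsion_of_supersingular W p hp2 hgood hap' P (by convert hP)

end Summit.BirchSwinnertonDyer.BirchSwinnertonDyer.Theorems.KimCor315

/-! ## §2 The Literature fact BY NAME from CASSELS, PT-Ш and a displayed TRANSPORT identity (kept general: any future transport feeds it) -/

namespace Summit.BirchSwinnertonDyer.BirchSwinnertonDyer.Theorems.KimCor315

open Literature.NumberTheory.EllipticCurves Literature.NumberTheory.GaloisRepresentations
  WeierstrassCurve ZpExtension Literature.NumberTheory.EllipticCurves.Kobayashi2003
  Literature.NumberTheory.EllipticCurves.Sprung2017 Literature.NumberTheory.EllipticCurves.Sprung2012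
  Literature.NumberTheory.GaloisCohomology
  Summit.BirchSwinnertonDyer.BirchSwinnertonDyer.Theorems.SignedEC

/-- **`BDKim2013.cor315_signedCharValue_rankZero` from CASSELS by name, PT-Ш and the TRANSPORT identity** — PT3ℝ / PT2ℝ dropped
(odd `p`). CONDITIONAL. [cite: BDKim2013, Cor. 3.15 (p. 199)] [cite: Sprung2012, §1 p. 1486, Thm. 2.2] [cite: MilneADT2006, Ch. I, Thm. 4.10 (a)] -/
theorem cor315_of_cassels_of_poitouTateSha_of_signedEqChromatic_odd (hC : Greenberg1999.casselsSurjectivity_H1Sigma ℚ)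
    (hPT : poitouTate_sha_tateDual ℚ)
    (hT : ∀ (ε : ℤˣ) (W : WeierstrassCurve ℚ) [W.IsElliptic] [W.IsGloballyMinimal] (p : ℕ) [Fact p.Prime],
      p ≠ 2 → W.HasGoodReductionAtPrime p → W.frobeniusTrace p = 0 →
      ∀ (κ : ZpExtension ℚ p), κ.IsCyclotomic → ∀ (v : HeightOneSpectrum (𝓞 ℚ)), (p : 𝓞 ℚ) ∈ v.asIdeal →
      ∃ (g : Field.absoluteGaloisGroup (v.adicCompletion ℚ)) (cneg : localPoints W (v.adicCompletion ℚ))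
        (c : ℕ → localPoints W (v.adicCompletion ℚ)) (col : Chroma),
        κ.IsTopGenerator (resGalOfEmb (closureEmb (K := ℚ) (v.adicCompletion ℚ)) g) ∧
        IsHondaSystem κ (closureEmb (K := ℚ) (v.adicCompletion ℚ)) W (W.frobeniusTrace p) g cneg c ∧
        signedSelmerInfty W κ ε =
          sharpFlatSelmerInfty W κ (closureEmb (K := ℚ) (v.adicCompletion ℚ)) (W.frobeniusTrace p) g c col) :
    BDKim2013.cor315_signedCharValue_rankZero := by
  intro W _ _ p _ hp2 hgood hap κ γ hκ hγ ε D _ _ f hf hSel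
  obtain ⟨v, hv⟩ : ∃ v : HeightOneSpectrum (𝓞 ℚ), ((p : ℕ) : 𝓞 ℚ) ∈ v.asIdeal :=
    Literature.NumberTheory.EllipticCurves.exists_heightOneSpectrum_natCast_mem (K := ℚ) (Fact.out : p.Prime)
  obtain ⟨g, cneg, c, col, hg, hH, heq⟩ := hT ε W p hp2 hgood hap κ hκ v (by exact_mod_cast hv)
  exact (cor315_body_of_cassels_of_poitouTateSha_of_honda_of_eq_odd hC hPT hp2 hgood hap hκ hγ D (by exact_mod_cast hv)
    hg hH heq hSel f hf).2

/-! ## §3 The Literature fact BY NAME and the three route doors from {PT-Sel, PT-Ш} and NOTHING ELSE -/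

/-- **`BDKim2013.cor315_signedCharValue_rankZero` from CASSELS by name and PT-Ш — both signs, TRANSPORT by p621647's
`exists_isHondaSystem_signedSelmerInfty_eq_chromatic`, no archimedean row.** CONDITIONAL. [cite: BDKim2013, Cor. 3.15 (p. 199)]
[cite: GreenbergLNM1716, §4 Prop. 4.13 (p. 122)] [cite: MilneADT2006, Ch. I, Thm. 4.10 (a), Cor. 4.16] -/
theorem cor315_of_cassels_of_poitouTateSha (hC : Greenberg1999.casselsSurjectivity_H1Sigma ℚ) (hPT : poitouTate_sha_tateDual ℚ) :
    BDKim2013.cor315_signedCharValue_rankZero :=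
  cor315_of_cassels_of_poitouTateSha_of_signedEqChromatic_odd hC hPT
    fun ε W _ _ p _ hp2 hgood hap κ hκ v hv ↦
      exists_isHondaSystem_signedSelmerInfty_eq_chromatic ε W p hp2 hgood hap κ hκ v hv

/-- **B. D. Kim 2013 Cor. 3.15 — `BDKim2013.cor315_signedCharValue_rankZero` — from the TWO generic Poitou–Tate rows over `ℚ`**
(`poitouTate_selmerStructure_duality ℚ` = item 20461's text, `poitouTate_sha_tateDual ℚ` = item 20462's; CASSELS by
`SignedEC.CasselsPT.casselsSurjectivity_H1Sigma_of_poitouTate`): as p621647's `cor315_of_poitouTate_rows` WITHOUT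
`poitouTate_three_realPlaces_injective ℚ` / `poitouTate_two_realPlaces_surjective ℚ`. So the by-name input F10 of rows 6–8 is CONDITIONAL on
exactly {PT-Sel, PT-Ш}. [cite: BDKim2013, Cor. 3.15 (p. 199)] [cite: MilneADT2006, Ch. I, Thm. 4.10, Cor. 4.16] [cite: Cassels1964ArithmeticVII] -/
theorem cor315_of_poitouTate_two_rows (hPTs : poitouTate_selmerStructure_duality ℚ) (hPT : poitouTate_sha_tateDual ℚ) :
    BDKim2013.cor315_signedCharValue_rankZero :=
  cor315_of_cassels_of_poitouTateSha (CasselsPT.casselsSurjectivity_H1Sigma_of_poitouTate hPTs) hPT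

/-- **Route `SignedLowerHalves`, support `BDKimSignedCharValueRankZero` (item 19288) ⟸ the TWO Poitou–Tate rows {PT-Sel, PT-Ш}.**
CONDITIONAL result (the two rows are named facts); the item is not closed. [cite: BDKim2013, Cor. 3.15 (p. 199)]
[cite: MilneADT2006, Ch. I, Thm. 4.10, Cor. 4.16] -/
theorem signedLowerHalves_bdKimSignedCharValueRankZero_of_poitouTate_two_rows
    (hPTs : poitouTate_selmerStructure_duality ℚ) (hPT : poitouTate_sha_tateDual ℚ) :
    Summit.BirchSwinnertonDyer.BirchSwinnertonDyer.Theses.SignedLowerHalves.BDKimSignedCharValueRankZero :=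
  cor315_of_poitouTate_two_rows hPTs hPT

/-- **Route `SignedBaseChange`, support `BDKimSignedCharValueRankZero` (item 19288) ⟸ the TWO Poitou–Tate rows {PT-Sel, PT-Ш}.**
CONDITIONAL result; the item is not closed. [cite: BDKim2013, Cor. 3.15 (p. 199)] [cite: MilneADT2006, Ch. I, Thm. 4.10, Cor. 4.16] -/
theorem signedBaseChange_bdKimSignedCharValueRankZero_of_poitouTate_two_rows
    (hPTs : poitouTate_selmerStructure_duality ℚ) (hPT : poitouTate_sha_tateDual ℚ) :
    Summit.BirchSwinnertonDyer.BirchSwinnertonDyer.Theses.SignedBaseChange.BDKimSignedCharValueRankZero :=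
  cor315_of_poitouTate_two_rows hPTs hPT

/-- **Route `PrintX6`, support `InputKimCor315` (item 19288) ⟸ the TWO Poitou–Tate rows {PT-Sel, PT-Ш}.** CONDITIONAL result; the item
is not closed. [cite: BDKim2013, Cor. 3.15 (p. 199)] [cite: MilneADT2006, Ch. I, Thm. 4.10, Cor. 4.16] -/
theorem printX6_inputKimCor315_of_poitouTate_two_rows
    (hPTs : poitouTate_selmerStructure_duality ℚ) (hPT : poitouTate_sha_tateDual ℚ) :
    Summit.BirchSwinnertonDyer.BirchSwinnertonDyer.Theses.PrintX6.InputKimCor315 :=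
  cor315_of_poitouTate_two_rows hPTs hPT

end Summit.BirchSwinnertonDyer.BirchSwinnertonDyer.Theorems.KimCor315

end
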